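import Summits.CriticalPhenomena.PercolationContinuityZ3.Theorems.PercNearOneGluingNoHeavyPcintNawMemZ4M10Defs
import HarnessLib

/-!
# PCINT lane, kernel reduced-state B2r certificate `Z4M10` (d = 4, memory τ = 10, 729 state classes): row checks 1 (rows [0, 729))

Cell `prim-pcint`, seat `prim-pcint-1` (gen 5); memo `run/shared/lean/prim/pcint/INTERVAL-PLAN.md` §16 ("checker for the reduced-state
automata").  Does NOT build on p205010.  Data for `NawK.le_siteCriticalProb_of_checkRows` (`…PcintNawRandMemKernelCert`): `p = 16820/100000`,
`q̄ = 97404/100000` (`q̄^7·100000^7 ≥ (100000-16820)·100000^6`), `κ̄ = (100000+97404)/(2·100000)`, `λ = 99999/100000`; Collatz–Wielandt weights (scale 10⁹) from a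
power iteration, exact off-line max row ratio 0.9997594500 < λ.  Generated by gen5/gen_lean.py (pcint-1 folder); the kernel re-checks every row.
-/

namespace Summit.CriticalPhenomena.PercolationContinuityZ3.Theorems.Pcint.NawMemZ4M10

set_option maxHeartbeats 0 in
/-- Rows `[0, 100)` pass the check. [folklore] -/
theorem chk_0 : WinK.allRange chk 0 100 = true :=
  WinK.allRange_of_allRangeB (fuel := 8) (lo := 0) (len := 100) (by decide +kernel)

set_option maxHeartbeats 0 in
/-- Rows `[100, 200)` pass the check. [folklore] -/
theorem chk_100 : WinK.allRange chk 100 200 = true :=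
  WinK.allRange_of_allRangeB (fuel := 8) (lo := 100) (len := 100) (by decide +kernel)

set_option maxHeartbeats 0 in
/-- Rows `[200, 300)` pass the check. [folklore] -/
theorem chk_200 : WinK.allRange chk 200 300 = true :=
  WinK.allRange_of_allRangeB (fuel := 8) (lo := 200) (len := 100) (by decide +kernel)

set_option maxHeartbeats 0 in
/-- Rows `[300, 400)` pass the check. [folklore] -/
theorem chk_300 : WinK.allRange chk 300 400 = true :=
  WinK.allRange_of_allRangeB (fuel := 8) (lo := 300) (len := 100) (by decide +kernel)

set_option maxHeartbeats 0 in
/-- Rows `[400, 500)` pass the check. [folklore] -/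
theorem chk_400 : WinK.allRange chk 400 500 = true :=
  WinK.allRange_of_allRangeB (fuel := 8) (lo := 400) (len := 100) (by decide +kernel)

set_option maxHeartbeats 0 in
/-- Rows `[500, 600)` pass the check. [folklore] -/
theorem chk_500 : WinK.allRange chk 500 600 = true :=
  WinK.allRange_of_allRangeB (fuel := 8) (lo := 500) (len := 100) (by decide +kernel)

set_option maxHeartbeats 0 in
/-- Rows `[600, 700)` pass the check. [folklore] -/
theorem chk_600 : WinK.allRange chk 600 700 = true :=
  WinK.allRange_of_allRangeB (fuel := 8) (lo := 600) (len := 100) (by decide +kernel)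

set_option maxHeartbeats 0 in
/-- Rows `[700, 729)` pass the check. [folklore] -/
theorem chk_700 : WinK.allRange chk 700 729 = true :=
  WinK.allRange_of_allRangeB (fuel := 8) (lo := 700) (len := 29) (by decide +kernel)

/-- Rows `[0, 729)` pass the check. [folklore] -/
theorem file_1 : WinK.allRange chk 0 729 = true := (WinK.allRange_split (WinK.allRange_split (WinK.allRange_split (WinK.allRange_split (WinK.allRange_split (WinK.allRange_split (WinK.allRange_split chk_0 chk_100) chk_200) chk_300) chk_400) chk_500) chk_600) chk_700)

end Summit.CriticalPhenomena.PercolationContinuityZ3.Theorems.Pcint.NawMemZ4M10
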